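import Summits.KontsevichZagierPeriods.KontsevichZagierPeriods.Theorems.VietaFibreKernelFormCancellerNormalForm
import HarnessLib

/-!
# Crux `KernelForm` (stmt-KontsevichZagierPeriods-10447), line `Sketch`: the WEAK KERNEL in
# canceller normal form

`WeakKernel := ∀ c, KZ.eval c = 0 → ∃ s, KZ.eval s ≠ 0 ∧ s * c ∈ KZ.relations` is the arithmetic
half of the cut `KernelForm ↔ WeakKernel ∧ Cancellation`. This file proves, unconditionally, that
the multiplier `s` can be normalised to ONE compact volume form:

* `weakKernel_iff_exists_compact` — `WeakKernel` holds iff every formal combination `c` of value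
  `0` is killed, modulo the moves, by some `[K, 1]` with `K ⊆ ℝ^{k+1}` compact `ℚ`-semialgebraic of
  non-empty interior: `[K, 1] * c ∈ KZ.relations`.

Proof. (`→`) WLOG `0 < eval s` (replace `s` by `-s`); decompose `s ≡ [A] − [B]` into bounded volume
forms of one dimension (`stub_boundedDecomposition`), pack `[A] − [B] ≡ [K]` inside the rules
(Viu-Sos, `KZ.exists_isCompact_of_sub_of_sub_mem_relations`), and chase the right ideal
`KZ.relations`. (`←`) `[K, 1]` has value `vol K > 0` since `K` has non-empty interior.
All statements are inline over the calculus (no new definitions).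

References: M. Kontsevich, D. Zagier, *Periods* (2001), §1.2 (rules), §4.1 (products);
J. Viu-Sos, *A semi-canonical reduction for periods of Kontsevich–Zagier*, IJNT 17 (2021), §4
[ViuSos2021].
-/

noncomputable section

open MeasureTheory Set
open Literature.NumberTheory.Transcendental

namespace Summit.KontsevichZagierPeriods.KernelForm.LocaliseAtValuePrime

/-- **Compact canceller from a canceller of positive value.** From `s * c ∈ relations` with
`0 < eval s`: decompose `s ≡ [A] − [B]` into bounded volume forms (`stub_boundedDecomposition`),
pack `[A] − [B] ≡ [K]` with `K` compact of non-empty interior and integrand `1`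
(`KZ.exists_isCompact_of_sub_of_sub_mem_relations`), and conclude `[K] * c ∈ relations` since
`relations` is a right ideal. [cite: ViuSos2021, §4] [folklore] -/
theorem exists_compact_canceller_of_pos (c s : KZ.FormalRep) (hv : 0 < KZ.eval s)
    (hsc : s * c ∈ KZ.relations) :
    ∃ (k : ℕ) (K : KZ.IntegralRep (k + 1)), IsCompact K.domain ∧ (interior K.domain).Nonempty ∧
      (∀ x ∈ K.domain, K.integrand x = 1) ∧ KZ.of K * c ∈ KZ.relations := by
  -- (1) bounded decomposition `s ≡ [A] − [B]`
  obtain ⟨k, A, B, hAb, hBb, hA1, hB1, hsAB⟩ := stub_boundedDecomposition s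
  have hvAB : KZ.eval s = A.value - B.value := by
    have h := eval_eq_zero_of_mem hsAB
    simp only [map_sub, KZ.eval_of] at h
    linarith
  -- (2) `([A] − [B]) * c ∈ relations`
  have h1 : (KZ.of A - KZ.of B) * c ∈ KZ.relations := by
    have h := KZ.mul_mem_relations_right_holds _ c hsAB
    rw [sub_mul] at h
    have : (KZ.of A - KZ.of B) * c = s * c - (s * c - (KZ.of A - KZ.of B) * c) := by abel
    rw [this]
    exact KZ.relations.sub_mem hsc h
  -- (3) packing `[A] − [B] ≡ [K]`
  obtain ⟨K, hKc, hKint, hK1, hABK⟩ :=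
    KZ.exists_isCompact_of_sub_of_sub_mem_relations A B hAb hBb hA1 hB1 (by linarith)
  have h2 : KZ.of K * c ∈ KZ.relations := by
    have h := KZ.mul_mem_relations_right_holds _ c hABK
    rw [sub_mul] at h
    have : KZ.of K * c = (KZ.of A - KZ.of B) * c - ((KZ.of A - KZ.of B) * c - KZ.of K * c) := by
      abel
    rw [this]
    exact KZ.relations.sub_mem h1 h
  exact ⟨k, K, hKc, hKint, hK1, h2⟩

/-- A representation with compact domain of non-empty interior and integrand `1` has positive value
(the volume of its domain). [folklore] -/
theorem eval_of_pos_of_isCompact_of_interior_nonempty {m : ℕ} (K : KZ.IntegralRep m)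
    (hKc : IsCompact K.domain) (hKint : (interior K.domain).Nonempty)
    (hK1 : ∀ x ∈ K.domain, K.integrand x = 1) : 0 < KZ.eval (KZ.of K) := by
  rw [KZ.eval_of, KZ.IntegralRep.value_eq_volume_real K hK1, measureReal_def]
  exact ENNReal.toReal_pos (Measure.measure_pos_of_nonempty_interior volume hKint).ne'
    hKc.measure_lt_top.ne

/-- **WEAK KERNEL IN CANCELLER NORMAL FORM** (unconditional). Every formal combination of value
`0` admits a canceller of non-zero value iff every formal combination of value `0` is killed,
modulo the moves, by a single compact volume form `[K, 1]` (`K ⊆ ℝ^{k+1}` compact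
`ℚ`-semialgebraic with non-empty interior). (`→`: sign change to a canceller of positive value,
then `exists_compact_canceller_of_pos`; `←`: `[K, 1]` has value `vol K > 0`.) [folklore] -/
theorem weakKernel_iff_exists_compact :
    (∀ c : KZ.FormalRep, KZ.eval c = 0 → ∃ s : KZ.FormalRep, KZ.eval s ≠ 0 ∧ s * c ∈ KZ.relations) ↔ ∀ c : KZ.FormalRep, KZ.eval c = 0 → ∃ (k : ℕ) (K : KZ.IntegralRep (k + 1)), IsCompact K.domain ∧ (interior K.domain).Nonempty ∧ (∀ x ∈ K.domain, K.integrand x = 1) ∧ KZ.of K * c ∈ KZ.relations := by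
  constructor
  · intro hW c hc
    obtain ⟨s, hs, hsc⟩ := hW c hc
    rcases lt_or_gt_of_ne hs with hneg | hpos
    · refine exists_compact_canceller_of_pos c (-s) ?_ ?_
      · rw [map_neg]; linarith
      · rw [neg_mul]; exact KZ.relations.neg_mem hsc
    · exact exists_compact_canceller_of_pos c s hpos hsc
  · intro hW c hc
    obtain ⟨k, K, hKc, hKint, hK1, hKc'⟩ := hW c hc
    exact ⟨KZ.of K, (eval_of_pos_of_isCompact_of_interior_nonempty K hKc hKint hK1).ne', hKc'⟩

end Summit.KontsevichZagierPeriods.KernelForm.LocaliseAtValuePrime
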